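import Summits.Ventures.Crystal3D.Theorems.StickyWulffConstantStackingLiminfPlateauProfile
import Summits.Ventures.Crystal3D.Theorems.StickyWulffConstantStackingLiminfBarlowCells
import HarnessLib

/-!
# Plateau height for line `LayerChain` v4 (crux `StackingLiminf`, stmt-Ventures-19145), part 3:
# the `K`-mollified density of a Barlow configuration never exceeds `√2 ∫φ_K + C/K`

Route `StickyWulffConstant` of the venture `Summits/Ventures/Crystal3D` (cell `crystal3d-full`).
**`dens_le_sqrt_two_mul_integral_bump_add`**: for every letter sequence `σ`, every injective finite
family `x` of points of `barlowStacking 1 √(2/3) σ`, every `K ≥ 1` and every `y`,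
`dens x K y = Σ_i φ_K(y − x_i) ≤ √2 · ∫ φ_K + 2592 √2 · bumpConst / K`.
With the masses `∫ φ_K = 1/√2` (rung R1) and `∫ η_L = 1` (rung R2) of the line this is the
plateau-height bound `smooth x K L ≤ 1 + C/K` (rung R6), the upper-height input of stub (C)
`stub_plateauBound` (planner cf-p1 g13, `LayerChainV4Rungs.lean`).
Proof = part 2 (cells `Q p`, volume `1/√2`, diameter `≤ 2`, disjoint) + part 1 (majorant):
`φ_K(y − x_i) = √2 ∫_{Q(x_i)} φ_K(y − x_i) ≤ √2 ∫_{Q(x_i)} Ψ_y`, sum over the DISJOINT cells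
(`integral_biUnion_finset`) `≤ √2 ∫ Ψ_y = √2 ∫ Ψ_0 ≤ √2 (∫φ_K + 12 c_K (2(K+2))³/K)`.
No layer cake, no lattice-point counting, no infinite sums.
WHAT THIS IS NOT: not R6 verbatim (needs R1/R2, owned by wulff-p2), not stub (C); rung F-C1 not moved.
-/

noncomputable section

namespace Summit.Ventures.Crystal3D.Theorems.PlateauHeight

open MeasureTheory Set Metric
open Literature.MathematicalPhysics.StatisticalMechanics (barlowPos barlowStacking haggLabel)
open Summit.Ventures.Crystal3D.Cruxes.StackingLiminf.LayerChainV4 (bump bumpConst dens eta smooth)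
open Summit.Ventures.Crystal3D.LayerChain (dot3)

/-! ### The plateau-height core: `v = dens x K ≤ √2 ∫φ_K + O(1/K)` uniformly -/

/-- **Plateau height, core estimate (rung R6 of line `LayerChain` v4 up to the masses R1/R2).**
For every Barlow stacking `Λ_σ = barlowStacking 1 √(2/3) σ` (any letter sequence `σ`), every
injective finite family `x` of points of `Λ_σ`, every `K ≥ 1` and every `y ∈ ℝ³`, the `K`-mollified
empirical density satisfies
`dens x K y = Σ_i φ_K(y − x_i) ≤ √2 · ∫ φ_K + 2592 √2 · bumpConst / K`.
With `∫ φ_K = 1/√2` (rung R1) this is `v ≤ 1 + C/K` uniformly in the word, the configuration and the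
point; averaging laterally with `η_L` (`∫ η_L = 1`, rung R2) gives the plateau height bound
`smooth x K L ≤ 1 + C/K` of rung R6 / stub (C).
Proof: each lattice point `p` owns a half-open cell `Q p` of volume `1/√2` inside `B̄(p, 2)`
(`exists_barlowCells`), cells of distinct points are disjoint, and on `Q p` the bump `φ_K(y − p)` is
dominated by the radially non-increasing majorant `c_K G((|q − y| − 2)/K)`; so
`φ_K(y − p) ≤ √2 ∫_{Q p} majorant`, the sum over the disjoint cells is `≤ √2 ∫ majorant`, and the
majorant exceeds `φ_K` by at most `12 c_K/K` on `B̄_∞(0, K + 2)` (the profile `G` is `6`-Lipschitz). -/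
theorem dens_le_sqrt_two_mul_integral_bump_add {N : ℕ} (s : ℤ → ℤ)
    (x : Fin N → EuclideanSpace ℝ (Fin 3)) (hx : Function.Injective x)
    (hmem : ∀ i, x i ∈ barlowStacking 1 (Real.sqrt (2 / 3)) s) {K : ℝ} (hK : 1 ≤ K)
    (y : Fin 3 → ℝ) :
    dens x K y ≤ Real.sqrt 2 * (∫ u, bump K u) + 2592 * Real.sqrt 2 * bumpConst / K := by
  have hK0 : 0 < K := by linarith
  have hr2 : 0 < Real.sqrt 2 := Real.sqrt_pos.2 (by norm_num)
  obtain ⟨Q, hQm, hQv, hQd, hQdisj⟩ := exists_barlowCells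
  choose kk ii jj hkij using fun i => (hmem i)
  -- the translated majorant
  set Ψ : (Fin 3 → ℝ) → ℝ := fun q =>
    bumpConst / K ^ 3 * (max 0 (1 - (max 0 ((Real.sqrt (dot3 (q - y) (q - y)) - 2) / K)) ^ 2)) ^ 3
    with hΨ
  have hΨ0 : ∀ q, 0 ≤ Ψ q := fun q =>
    mul_nonneg (div_nonneg bumpConst_pos.le (pow_nonneg hK0.le 3)) (profile_nonneg _)
  have hΨint : Integrable Ψ := integrable_majorant hK0 y
  have hvolR : ∀ p, (volume (Q p)).toReal = 1 / Real.sqrt 2 := fun p => by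
    rw [hQv, ENNReal.toReal_ofReal (by positivity)]
  -- per point: `φ_K(y − x_i) ≤ √2 ∫_{Q(x_i)} Ψ`
  have hpt : ∀ i, bump K (fun j => y j - x i j) ≤
      Real.sqrt 2 * ∫ q in Q (WithLp.ofLp (x i)), Ψ q := by
    intro i
    set p : Fin 3 → ℝ := WithLp.ofLp (x i) with hp
    have hfin : volume (Q p) < ⊤ := by rw [hQv]; exact ENNReal.ofReal_lt_top
    have h1 : ∫ q in Q p, bump K (fun j => y j - x i j) = (1 / Real.sqrt 2) * bump K (fun j => y j - x i j) := by
      rw [setIntegral_const, smul_eq_mul, measureReal_def, hvolR]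
    have h2 : ∫ q in Q p, bump K (fun j => y j - x i j) ≤ ∫ q in Q p, Ψ q := by
      refine setIntegral_mono_on ((integrableOn_const_iff).2 (Or.inr hfin)) hΨint.integrableOn (hQm p)
        fun q hq => ?_
      have := bump_le_majorant hK0 y p q (hQd p q hq)
      simpa [hΨ, hp] using this
    rw [h1] at h2
    rw [one_div, inv_mul_le_iff₀ hr2] at h2
    exact h2
  -- the cells of the `x_i` are pairwise disjoint
  have hdisj : Set.Pairwise (↑(Finset.univ : Finset (Fin N)))
      (Function.onFun Disjoint fun i => Q (WithLp.ofLp (x i))) := by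
    intro a _ b _ hab
    have hne : (kk a, ii a, jj a) ≠ (kk b, ii b, jj b) := by
      intro heq
      apply hab
      apply hx
      simp only [Prod.mk.injEq] at heq
      rw [hkij a, hkij b, heq.1, heq.2.1, heq.2.2]
    have := hQdisj s _ _ _ _ _ _ hne
    simp only [Function.onFun]
    rwa [hkij a, hkij b]
  have hsum : ∑ i, ∫ q in Q (WithLp.ofLp (x i)), Ψ q =
      ∫ q in ⋃ i ∈ (Finset.univ : Finset (Fin N)), Q (WithLp.ofLp (x i)), Ψ q :=
    (integral_biUnion_finset Finset.univ (fun i _ => hQm _) hdisj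
      (fun i _ => hΨint.integrableOn)).symm
  have hle_int : ∫ q in ⋃ i ∈ (Finset.univ : Finset (Fin N)), Q (WithLp.ofLp (x i)), Ψ q ≤
      ∫ q, Ψ q := setIntegral_le_integral hΨint (ae_of_all _ hΨ0)
  -- translate and compare with the bump
  have htrans : ∫ q, Ψ q = ∫ q : Fin 3 → ℝ, bumpConst / K ^ 3 *
      (max 0 (1 - (max 0 ((Real.sqrt (dot3 q q) - 2) / K)) ^ 2)) ^ 3 := by
    rw [hΨ]
    exact integral_sub_right_eq_self (fun q : Fin 3 → ℝ => bumpConst / K ^ 3 *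
      (max 0 (1 - (max 0 ((Real.sqrt (dot3 q q) - 2) / K)) ^ 2)) ^ 3) y
  have herr := integral_majorant_le hK0
  -- `(2(K+2))³ ≤ 216 K³` for `K ≥ 1`
  have hcube : 12 * bumpConst / K ^ 4 * (2 * (K + 2)) ^ 3 ≤ 2592 * bumpConst / K := by
    have hb := bumpConst_pos
    rw [div_mul_eq_mul_div, div_le_div_iff₀ (by positivity) (by positivity)]
    have h1 : K + 2 ≤ 3 * K := by linarith
    have h2 : (K + 2) ^ 3 ≤ (3 * K) ^ 3 := pow_le_pow_left₀ (by positivity) h1 3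
    calc 12 * bumpConst * (2 * (K + 2)) ^ 3 * K = 96 * bumpConst * K * (K + 2) ^ 3 := by ring
      _ ≤ 96 * bumpConst * K * (3 * K) ^ 3 := by gcongr
      _ = 2592 * bumpConst * K ^ 4 := by ring
  -- assemble
  calc dens x K y = ∑ i, bump K (fun j => y j - x i j) := rfl
    _ ≤ ∑ i, Real.sqrt 2 * ∫ q in Q (WithLp.ofLp (x i)), Ψ q := Finset.sum_le_sum fun i _ => hpt i
    _ = Real.sqrt 2 * ∑ i, ∫ q in Q (WithLp.ofLp (x i)), Ψ q := by rw [Finset.mul_sum]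
    _ ≤ Real.sqrt 2 * ∫ q, Ψ q := by
        rw [hsum]; exact mul_le_mul_of_nonneg_left hle_int hr2.le
    _ ≤ Real.sqrt 2 * ((∫ u, bump K u) + 12 * bumpConst / K ^ 4 * (2 * (K + 2)) ^ 3) := by
        rw [htrans]; exact mul_le_mul_of_nonneg_left herr hr2.le
    _ ≤ Real.sqrt 2 * (∫ u, bump K u) + 2592 * Real.sqrt 2 * bumpConst / K := by
        have := mul_le_mul_of_nonneg_left hcube hr2.le
        have e : Real.sqrt 2 * (2592 * bumpConst / K) = 2592 * Real.sqrt 2 * bumpConst / K := by ring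
        linarith


/-! ### Lateral averaging: `smooth ≤ (sup dens) · ∫ η_L` -/

/-- **Lateral averaging does not raise the height.**  If the `K`-mollified density is bounded by
`M` everywhere, then its lateral average satisfies `smooth x K L y ≤ M · ∫ η_L` (`η_L ≥ 0`).
With `dens_le_sqrt_two_mul_integral_bump_add` and the masses `∫ φ_K = 1/√2`, `∫ η_L = 1`
(rungs R1, R2) this is rung R6: `smooth x K L ≤ 1 + 2592 √2 · bumpConst / K`. -/
theorem smooth_le_mul_integral_eta {N : ℕ} (x : Fin N → EuclideanSpace ℝ (Fin 3)) {K L M : ℝ}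
    (hL : 0 < L) (hM : ∀ y, dens x K y ≤ M) (y : Fin 3 → ℝ) :
    smooth x K L y ≤ M * ∫ z, eta L z := by
  unfold smooth
  have hdc : Continuous (dens x K) := (contDiff_dens x K).continuous
  -- the integrand is continuous with compact support, hence integrable
  have hcont : Continuous fun z : ℝ × ℝ =>
      eta L z * dens x K (fun j => y j - (![z.1, z.2, 0] : Fin 3 → ℝ) j) := by
    refine (continuous_eta L).mul (hdc.comp ?_)
    refine continuous_pi fun j => ?_
    fin_cases j <;> simp <;> fun_prop
  have hsupp : ∀ z : ℝ × ℝ, z ∉ closedBall (0 : ℝ × ℝ) L →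
      eta L z * dens x K (fun j => y j - (![z.1, z.2, 0] : Fin 3 → ℝ) j) = 0 := by
    intro z hz
    rw [mem_closedBall, dist_zero_right, not_le, Prod.norm_def, lt_max_iff] at hz
    have hz' : L ≤ |z.1| ∨ L ≤ |z.2| := by
      rcases hz with h | h
      · exact Or.inl (by rw [← Real.norm_eq_abs]; exact h.le)
      · exact Or.inr (by rw [← Real.norm_eq_abs]; exact h.le)
    rw [eta_eq_zero_of_coord hL hz', zero_mul]
  have hint : Integrable fun z : ℝ × ℝ =>
      eta L z * dens x K (fun j => y j - (![z.1, z.2, 0] : Fin 3 → ℝ) j) :=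
    hcont.integrable_of_hasCompactSupport (HasCompactSupport.intro (isCompact_closedBall _ _) hsupp)
  have hint_eta : Integrable (eta L) :=
    (continuous_eta L).integrable_of_hasCompactSupport
      (HasCompactSupport.intro (isCompact_closedBall (0 : ℝ × ℝ) L) fun z hz => by
        have := hsupp z hz
        rw [mem_closedBall, dist_zero_right, not_le, Prod.norm_def, lt_max_iff] at hz
        have hz' : L ≤ |z.1| ∨ L ≤ |z.2| := by
          rcases hz with h | h
          · exact Or.inl (by rw [← Real.norm_eq_abs]; exact h.le)
          · exact Or.inr (by rw [← Real.norm_eq_abs]; exact h.le)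
        exact eta_eq_zero_of_coord hL hz')
  calc ∫ z : ℝ × ℝ, eta L z * dens x K (fun j => y j - (![z.1, z.2, 0] : Fin 3 → ℝ) j)
      ≤ ∫ z : ℝ × ℝ, eta L z * M :=
        integral_mono hint (hint_eta.mul_const M) fun z =>
          mul_le_mul_of_nonneg_left (hM _) (eta_nonneg L z)
    _ = M * ∫ z, eta L z := by rw [integral_mul_const, mul_comm]

end Summit.Ventures.Crystal3D.Theorems.PlateauHeight

end
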